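import Summits.QuantumFields.YangMills.Theorems.BalabanUVNodesN12AtRecord13OfResiduals
import Literature.MathematicalPhysics.QuantumFieldTheory.Balaban1983to89.B15Prop1IntrinsicOfRecord
import Literature.MathematicalPhysics.QuantumFieldTheory.Balaban1983to89.B15Eq177ValueInvarianceCoDiv

/-!
# BalabanUVNodes ∕ N12 — THE s1∕s2 JUNCTION: N12's ROW AT THE LIVE RE-PIN WITH ITS PROPOSITION-1 DISPLAY DISCHARGED AT PRINT's SU(2) BOX INSTANCE OF THE (1.77) FUNCTION AT
# NODE 00's (2.12) SOLUTION MAP OF RECORD, ON THE RUN's OWN LATTICE — by dag-n12-c's `B15Prop1IntrinsicOfRecord.exists_domain_prop1Printed_lfVarOn_std_su2_box_intrinsic_analytic_ofRecord` (g6 FILE 4;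
# the (181) letter of the earlier endpoint p518722 is GONE, dag-n12-c LOCATED-181): the residual letter `λ.LF` PINNED to the carrier family
# `lfVarOn su2Chart (InstOn.std (bgOfRecord (av P) (reg P)) (M₁ P) (Z P i) (Λ P i) (k P i) (M P i) (areg P i) (anExt …))` on `F.P P.K`, the thresholds `areg` (print's `a₁`, p. 194) produced by
# Prop. 1's proof; §2 at `N = 2` with the background THE v1.5 `CoP` BACKGROUND CONSTRUCTOR OF RECORD `bgMSCoPOfRecord F 2 Θ.ν P.K (kb P) (Ω P)` (node00-def-R FILE 22′) and `M₁ := Θ.ν.M₁`, the class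
# gauge-invariance letter DISCHARGED by dag-n12-c's `B15Eq177ValueInvarianceCoDiv.gaugeAct_mem_regMSCoPOfRecordAt` (Track A, DAG node N12 = [B15, Balaban1989LargeFieldI] CMP **122** (1989) 175–202;
# cluster K1 (K1⁵ `StabilityBAtRecordR13SepCoP` = stmt-QuantumFields-20294, rev 20); seat `pub-ymgap-dag-n12-d` g10 (R134 s2 = by-name knit at the record), 2026-08-27; count-neutral, NOT a discharge)

HONEST FRAMING.  Count-neutral kernel COMPOSITION BY NAME: this seat's 12E (`b15Leaf_WOfRecord₁₃_liveRepin₁₃_of_massLive_of_hasResiduals` — N12's row at the live re-pin of any `Θ` carrying node00-def-K0b's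
residuals from the (1.100) pin equation + live-mass + Prop. 1 + (1.80) + (1.89); background-free, 𝐓-weight-free) with its `hP1 : Prop1Printed (λ.LF P)` display FED by dag-n12-c's N12∕s1 endpoint
OF RECORD (Proposition 1 [IV] AS PRINTED, including its analytic-extension clause `anExt`, at print's instance `InstOn.std` — parallelepipeds, `SU(2)`, x₁-axial `G₀`, the p. 193 extension — for the
(1.77) function `fun177std (bgOfRecord av reg) M₁ Z k = A(U_{k,Z}(·))` at NODE 00's (2.12) solution map `bgOfRecord av reg` of ANY gauge-invariant class `reg`, from the letters (J1) joint holomorphy of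
`(p, B′) ↦ A(U_{k,Z}(exp(iB′)·ext(exp(ip)V_k)))`, (L2) (1.7)–(1.9) for the slice Hessian at `0`, (L3) smallness of the slice gradient at `0`, the class invariance `hreg`, `hk`, and structural box data;
p. 194's *«The function is invariant with respect to the group of all gauge transformations defined on Λ»* is dag-n12-c's THEOREM `B15Eq177ValueInvariance.fun177std_bgOfRecord_gaugeAct` there).
WHAT IS PINNED HERE: the [IV] layer's Proposition-1 carrier `λ.LF P` := print's instance family ON THE RUN's OWN LATTICE `F.P P.K` (group `SU2 = SU 2`) for print's function at NODE 00's solution map;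
in §2 moreover the background := the v1.5 background constructor of record `bgMSCoPOfRecord F 2 Θ.ν P.K (kb P) (Ω P) = bgOfRecord (avOfRecord F 2 P.K) (regMSCoPOfRecordAt …)` (`rfl`) and `M₁ := Θ.ν.M₁`.
WHAT STAYS A LETTER: in §1 the averaging `av P` and the class `reg P` (with `hreg`); in §2 ONE class per run — its step count `kb P` and region history `Ω P` (print applies Proposition 1 term by
term, one background per large-field history `s`: a family of instance families indexed by the histories of the run is NODE 00's LF pin, not attempted here); everywhere the regions `Z P i ∕ Λ P i`,
levels `k P i`, `M P i`, the box data.  The bundle's `LF` letter is group-agnostic as typed (`B15.LFVar` is an abstract carrier), so §1 elaborates at every `N` (intended reading `N = 2`); §2 is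
stated at `N = 2`.  Nothing of Bałaban's is asserted: (J1)∕(L2)∕(L3) are [Balaban1985Variational]-Thm-1-level inputs of NODE 00 (dag-n12-c's HONEST SCOPE); N12 is NOT discharged; no node is
discharged; counts unmoved (Track A discharged 5∕28).  TYPING NOTE: dag-n12-c's chain is elaborated at the classical `DecidableEq (PBond …)` while the Record-13 cone carries the global
`B6Prop26ReachTransplant.instDecidableEqPBond`; the n12-c-side hypothesis bodies and the pinned `LF` term are therefore written under
`letI : DecidableEq (PBond (F.P P.K) (k P i)) := fun a b => Classical.propDecidable (a = b)` (inlined at elaboration; no attribute, no instance declared).  ONE finite four-torus programme at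
fixed `ε = L^{-K}` — nothing continuum ∕ ℝ⁴ ∕ OS ∕ mass gap ∕ Clay.
-/

noncomputable section

open MeasureTheory Set Finset Metric
open scoped Matrix.Norms.L2Operator BigOperators Matrix RealInnerProductSpace Real InnerProductSpace

namespace Summit.QuantumFields.YangMills.BalabanUVNodes.N12AtRecord13Prop1Knit

open Literature.MathematicalPhysics.QuantumFieldTheory.Balaban1983to89
open Literature.MathematicalPhysics.QuantumFieldTheory.Balaban1983to89.T4Continuum (T4Family)
open Literature.MathematicalPhysics.QuantumFieldTheory.Balaban1983to89.DagBinding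
open Literature.MathematicalPhysics.QuantumFieldTheory.Balaban1983to89.Node00
open B15Claim189Assembly (new189 chiPP dom)
open B15 (Prop1Printed Ineq180)
open B15.BasicStep (Claim189)
open B8Eq17ClassAkV1 (plaqsOf)
open B15RPrime1100OfRep (rPrimeDataOfSel)
open Summit.QuantumFields.YangMills.BalabanUVNodes.N12AtRecord13OfResiduals (b15Leaf_WOfRecord₁₃_liveRepin₁₃_of_massLive_of_hasResiduals)
-- dag-n12-c's vocabulary (as opened in `B15Prop1IntrinsicAnalyticAtRecord`)
open B15DeterminingSets (pts DetBackground)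
open B15Prop1Carrier (lfVarOn InstOn InstOn.std plaqsInside)
open B15Prop1IntrinsicOfRecord (exists_domain_prop1Printed_lfVarOn_std_su2_box_intrinsic_analytic_ofRecord)
open B15Prop1AnalyticExtClause (cplxVec anExt)
open B15Prop1ChartCalculusSU2 (E3)
open T4CubeChartGnomonic (SU2)
open B15Prop1ChartSU2 (su2Chart)
open B15Prop1SliceCoordinates (GaugeSlice ιA)
open B15Prop1SliceTaylorCalculus (rGrad sliceFn)
open T4AxialGaugeSmallField (castSite boxPlaqs)
open B6BondElimination (unitVec)
open B16Eq18Proof (box)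
open B15Extension193 (extend)
open B15ShellGauge193 (shellGauge)
open B5Bounds167Lattice (formDk ofRealCfg)
open B15Sect1Instances (fun177std)
open B14.Eq213DetSet (Bj)
open B16Sect1Backgrounds (expMul)
open B15Eq177ValueInvarianceCoDiv (gaugeAct_mem_regMSCoPOfRecordAt)
open GaugeField (gaugeAct)

variable {N : ℕ} [NeZero N] {F : T4Family}

/-! ## §1. Generic `Θ` carrying node00-def-K0b's residuals (any `N`), background `bgOfRecord (av P) (reg P)` of a gauge-invariant class — at the live re-pin and at `θ₁₅ᶜ` -/

section Live
variable (Θ : Stage13Params F N) (lam : ResidW F N)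

/-- **★★ N12's ROW FOR THE RUNS BELOW THE TORUS AT THE ₁₃ LIVE RE-PIN, WITH THE PROPOSITION-1 DISPLAY DISCHARGED AT PRINT's SU(2) BOX INSTANCE OF (1.77) AT NODE 00's SOLUTION MAP** —
12E's `b15Leaf_WOfRecord₁₃_liveRepin₁₃_of_massLive_of_hasResiduals` at the LF-PINNED layer
`{λ with LF := fun P => lfVarOn su2Chart (InstOn.std (bgOfRecord (av P) (reg P)) (M₁ P) (Z P ·) (Λ P ·) (k P ·) (M P ·) (areg P ·) (anExt …))}` on the run's lattice `F.P P.K`, its `hP1` slot fed, run by run,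
by dag-n12-c's `exists_domain_prop1Printed_lfVarOn_std_su2_box_intrinsic_analytic_ofRecord`; the thresholds `areg P i > 0` (print's `a₁`, p. 194) are the ones Proposition 1's proof produces.
Displayed: K0b's residuals `hres`; per run below the torus the (1.100) pin equation, live-mass, (1.80), (1.89) (letters `λ.D189 ∕ λ.D1100` untouched by the pin); per run and instance
dag-n12-c's structural box data, `hk`, the class invariance `hreg`, and the three letters (J1) `hGj`, (L2) `hlead` + `hsm` ∕ `hγle`, (L3) `hJ`.  Count-neutral; NOT a discharge of N12.
[cite: Balaban1989LargeFieldI, (0.2)–(0.6) p.176, p.177 (i)–(ii), Prop. 1 (1.77)–(1.78) p.194 (incl. the last clause and the invariance sentence), p.193, (1.80) p.195, (1.89) p.198, (1.99)–(1.102) pp.200–201; Balaban1989LargeFieldII, (1.7)–(1.9) p.358, (1.11)–(1.13) p.359; Balaban1988Convergent, (2.12)–(2.13) pp.256–257, (3.16) p.268, (3.22)–(3.25) pp.269–270 (bookkeeping)] -/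
theorem exists_pinLF_b15Leaf_WOfRecord₁₃_liveRepin₁₃_of_massLive_of_hasResiduals_of_intrinsicLettersOfRecord (hres : Θ.HasResidualsOfRecord F N)
    -- N12's displays at the letters `kSel ∕ D189 ∕ D1100` of `λ`, run by run, BELOW THE TORUS
    (hpin : ∀ P : B12.RunParams, lam.kSel P < P.K → lam.D1100 P
      = rPrimeDataOfSel (reprTOfRecord₁₃ F N (Θ.liveRepin₁₃ F N) P (lam.kSel P))
          ((Θ.liveRepin₁₃ F N).ppSel P (gOfRecord₁₃ F N (Θ.liveRepin₁₃ F N) P) (lam.kSel P + 1))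
          (fibOfSeq F (Θ.liveRepin₁₃ F N).ν (Θ.liveRepin₁₃ F N).τ9 P (gOfRecord₁₃ F N (Θ.liveRepin₁₃ F N) P) (lam.kSel P + 1)))
    (hmassLive : ∀ P : B12.RunParams, lam.kSel P < P.K → ∀ s, LiveSeq F N Θ.ν Θ.τ9 P (gOfRecord₁₃ F N (Θ.liveRepin₁₃ F N) P) (lam.kSel P + 1)
        (slotsTOfRecord F N Θ.ν Θ.τ9 (EOfRecord₁₃ F N (Θ.liveRepin₁₃ F N)) (wOfRecord₉ F N (Θ.liveRepin₁₃ F N).toStage9Params)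
          (Θ.liveRepin₁₃ F N).ppSel P (gOfRecord₁₃ F N (Θ.liveRepin₁₃ F N) P) (lam.kSel P + 1)) s →
      0 < ∫ V, rterm (reprTOfRecord₁₃ F N (Θ.liveRepin₁₃ F N) P (lam.kSel P)) s V ∂(fieldMeasure (F.P P.K) (lam.kSel P + 1) (SU N)))
    (h180 : ∀ P : B12.RunParams, lam.kSel P < P.K → ∀ U, new189 (lam.D189 P) U → ∀ i, (lam.D189 P).h ≤ i → i ≤ (lam.D189 P).k →
      ∀ q ∈ plaqsOf (dom (lam.D189 P) i),
        Ineq180 ((lam.D189 P).dev0 U q) ((lam.D189 P).ε (lam.D189 P).k) (lam.D189 P).η (lam.D189 P).B₃ (lam.D189 P).B₅ (lam.D189 P).M (lam.D189 P).δ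
          ((lam.D189 P).dist q) (lam.D189 P).O1)
    (h189 : ∀ P : B12.RunParams, lam.kSel P < P.K → Claim189 (new189 (lam.D189 P)) (chiPP (lam.D189 P)))
    -- dag-n12-c's Proposition-1 instance data ON THE RUN's LATTICE `F.P P.K`, per run `P` and instance `i : ι P` (structural ∕ constants, exactly as in its endpoint of record)
    (hd3 : ∀ P : B12.RunParams, 3 ≤ (F.P P.K).d) (h0 : ∀ P : B12.RunParams, 0 < (F.P P.K).d) (ι : B12.RunParams → Type)
    (av : ∀ (P : B12.RunParams) (j : ℕ), Averaging (F.P P.K) j SU2)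
    -- NODE 00's (2.12) solution map of record `bgOfRecord (av P) (reg P)` in a GAUGE-INVARIANT class `reg P` (dag-n12-c FILE 1∕4: the (181) letter is GONE)
    (reg : ∀ P : B12.RunParams, Set (GaugeField (F.P P.K) 0 SU2))
    (hreg : ∀ (P : B12.RunParams) (w : GaugeTransf (F.P P.K) 0 SU2) (U : GaugeField (F.P P.K) 0 SU2), U ∈ reg P → gaugeAct w U ∈ reg P) (M₁ : B12.RunParams → ℕ) (Z Λ : ∀ P : B12.RunParams, ι P → Set (Site (F.P P.K) 0))
    (k : ∀ P : B12.RunParams, ι P → ℕ) (M : ∀ P : B12.RunParams, ι P → ℝ) (hk : ∀ P i, k P i ≤ (F.P P.K).m + (F.P P.K).K)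
    (eR : ∀ P : B12.RunParams, ι P → ℝ) (heR : ∀ P i, 0 < eR P i)
    (T : ∀ (P : B12.RunParams) (i : ι P), Finset (PBond (F.P P.K) (k P i)))
    (lo hi : ∀ P : B12.RunParams, ι P → Fin (F.P P.K).d → ℤ) (n : ∀ P : B12.RunParams, ι P → ℕ) (hn : ∀ P i κ, hi P i κ ≤ lo P i κ + n P i)
    (hN : ∀ P i, n P i + 2 < (F.P P.K).sitesPerDir (k P i))
    (hbox : ∀ P i, pts (k P i) (Λ P i) = (castSite '' Set.Icc (lo P i) (hi P i) : Set (Site (F.P P.K) (k P i))))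
    (hZ : ∀ P i, (boxPlaqs (lo P i - 1) (hi P i + 1) : Set (Plaq (F.P P.K) (k P i))) ⊆ plaqsInside (pts (k P i) (Z P i)))
    (hTG0 : ∀ P i, letI : DecidableEq (PBond (F.P P.K) (k P i)) := fun a b => Classical.propDecidable (a = b);
      T P i = (box (fun κ => (hi P i κ - lo P i κ + 1).toNat) (lo P i)).image fun x =>
      (⟨castSite (x - unitVec ⟨0, h0 P⟩), ⟨0, h0 P⟩⟩ : PBond (F.P P.K) (k P i)))
    (hN5 : ∀ P i κ, ((hi P i κ - lo P i κ + 1).toNat : ℤ) + 5 < (F.P P.K).sitesPerDir (k P i))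
    (Kb : ∀ P : B12.RunParams, ι P → ℕ) (hK1 : ∀ P i, 1 ≤ Kb P i) (hKn : ∀ P i κ, (hi P i κ - lo P i κ + 1).toNat ≤ Kb P i)
    (ext : ∀ (P : B12.RunParams) (i : ι P), GaugeField (F.P P.K) (k P i) SU2 → GaugeField (F.P P.K) (k P i) SU2)
    (hext : ∀ P i Vk, ext P i Vk = extend (pts (k P i) (Λ P i)) (shellGauge Vk (lo P i) (hi P i)) Vk)
    (hlohi : ∀ P i, lo P i ≤ hi P i)
    {γ cJ bx : B12.RunParams → ℝ} (hγ : ∀ P, 0 < γ P) (hcJ : ∀ P, 0 ≤ cJ P) (hbx : ∀ P, 0 ≤ bx P)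
    (hbxM : ∀ P i, 12 * ((F.P P.K).d : ℝ) * ((n P i : ℝ) + 2) ^ 2 ≤ bx P * (M P i) ^ 2)
    {Cerr R 𝓐 : ∀ P : B12.RunParams, ι P → ℝ} (hM : ∀ P i, 1 ≤ M P i) (hR : ∀ P i, 0 < R P i) (h𝓐 : ∀ P i, 0 ≤ 𝓐 P i)
    (n' : ∀ P : B12.RunParams, ι P → ℕ) (hn' : ∀ P i, 1 ≤ n' P i)
    -- (J1) the JOINT holomorphic extension of print's function in the datum perturbation and the field
    (hGj : ∀ P i Vk, PlaqSmallOn (plaqsInside (pts (k P i) (Z P i ∩ (Λ P i)ᶜ))) (eR P i) Vk →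
      ∃ 𝒢 : VecField (F.P P.K) (k P i) (EuclideanSpace ℂ (Fin 3)) × VecField (F.P P.K) (k P i) (EuclideanSpace ℂ (Fin 3)) → ℂ,
        DifferentiableOn ℂ 𝒢 (ball 0 (R P i)) ∧
        (∀ z ∈ ball (0 : VecField (F.P P.K) (k P i) (EuclideanSpace ℂ (Fin 3)) × VecField (F.P P.K) (k P i) (EuclideanSpace ℂ (Fin 3))) (R P i), ‖𝒢 z‖ ≤ 𝓐 P i) ∧
        ∀ p B' : VecField (F.P P.K) (k P i) E3, ‖p‖ < R P i → ‖B'‖ < R P i →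
          𝒢 (cplxVec p, cplxVec B') =
            ((fun177std (bgOfRecord (av P) (reg P)) (M₁ P) (Z P i) (k P i) (expMul su2Chart B' (ext P i (expMul su2Chart p Vk))) : ℝ) : ℂ))
    -- (L2) (1.7)–(1.9) p.358 for the Hessian of the slice function at `0`
    (hlead : ∀ P i Vk, letI : DecidableEq (PBond (F.P P.K) (k P i)) := fun a b => Classical.propDecidable (a = b);
      PlaqSmallOn (plaqsInside (pts (k P i) (Z P i ∩ (Λ P i)ᶜ))) (eR P i) Vk →
      ∀ X : GaugeSlice (pts (k P i) (Λ P i)) (T P i) E3,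
      |⟪X, (fderiv ℝ (rGrad (pts (k P i) (Λ P i)) (T P i)
              (sliceFn (pts (k P i) (Λ P i)) (T P i) (fun177std (bgOfRecord (av P) (reg P)) (M₁ P) (Z P i) (k P i)) (ext P i Vk))) 0) X⟫ -
          ∑ a : Fin 3, formDk (n' P i) (fun _ : Fin (F.P P.K).d => (F.P P.K).sitesPerDir (k P i))
            (ofRealCfg (fun _ : Fin (F.P P.K).d => (F.P P.K).sitesPerDir (k P i)) fun j =>
              ιA (pts (k P i) (Λ P i)) (T P i) X ⟨j.1, j.2⟩ a)| ≤ Cerr P i * ‖X‖ ^ 2)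
    (hsm : ∀ P i, Cerr P i ≤ (4 / Real.pi ^ 2) ^ ((F.P P.K).d + 2) / (2 * (3 * (Kb P i : ℝ) ^ 2 + 2 * (Kb P i : ℝ) ^ 4)))
    (hγle : ∀ P i, γ P / (M P i) ^ 5 ≤ (4 / Real.pi ^ 2) ^ ((F.P P.K).d + 2) / (2 * (3 * (Kb P i : ℝ) ^ 2 + 2 * (Kb P i : ℝ) ^ 4)))
    -- (L3) p.359: the gradient at `0` is small at regular data
    (hJ : ∀ P i ε Vk, letI : DecidableEq (PBond (F.P P.K) (k P i)) := fun a b => Classical.propDecidable (a = b);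
      0 < ε → ε ≤ eR P i → PlaqSmallOn (plaqsInside (pts (k P i) (Z P i ∩ (Λ P i)ᶜ))) ε Vk →
      ‖rGrad (pts (k P i) (Λ P i)) (T P i) (sliceFn (pts (k P i) (Λ P i)) (T P i) (fun177std (bgOfRecord (av P) (reg P)) (M₁ P) (Z P i) (k P i)) (ext P i Vk)) 0‖ ≤ cJ P * ε) :
    ∃ areg : ∀ P : B12.RunParams, ι P → ℝ, (∀ P i, 0 < areg P i) ∧
      ∀ P : B12.RunParams, lam.kSel P < P.K →
        B15Leaf (WOfRecord₁₃ F N (Θ.liveRepin₁₃ F N)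
          { lam with LF := fun P => lfVarOn su2Chart fun i => letI : DecidableEq (PBond (F.P P.K) (k P i)) := fun a b => Classical.propDecidable (a = b);
                          InstOn.std (bgOfRecord (av P) (reg P)) (M₁ P) (Z P i) (Λ P i) (k P i) (M P i) (areg P i)
                            (anExt (pts (k P i) (Λ P i)) (T P i) (fun177std (bgOfRecord (av P) (reg P)) (M₁ P) (Z P i) (k P i)) (ext P i)
                              (min (1 / 2) (min (R P i / 8) (γ P / (M P i) ^ 5 * (R P i / 2) ^ 2 / (48 * (4 * 𝓐 P i / R P i + 1)))))) } P) := by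
  classical
  choose areg ha hP using fun P : B12.RunParams =>
    exists_domain_prop1Printed_lfVarOn_std_su2_box_intrinsic_analytic_ofRecord (hd3 := hd3 P) (h0 := h0 P) (av := av P) (reg := reg P) (hreg := hreg P)
      (M₁ := M₁ P) (Z := Z P) (Λ := Λ P) (k := k P) (M := M P) (hk := hk P) (eR := eR P) (heR := heR P) (T := T P) (lo := lo P) (hi := hi P) (n := n P) (hn := hn P)
      (hN := hN P) (hbox := hbox P) (hZ := hZ P) (hTG0 := hTG0 P) (hN5 := hN5 P) (K := Kb P) (hK1 := hK1 P) (hKn := hKn P) (ext := ext P) (hext := hext P) (hlohi := hlohi P)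
      (hγ := hγ P) (hcJ := hcJ P) (hbx := hbx P) (hbxM := hbxM P) (hM := hM P) (hR := hR P) (h𝓐 := h𝓐 P) (n' := n' P) (hn' := hn' P) (hGj := hGj P) (hlead := hlead P)
      (hsm := hsm P) (hγle := hγle P) (hJ := hJ P)
  refine ⟨areg, ha, fun P hkP => ?_⟩
  -- unify the LF-pinned layer from the goal first (the displays then match by projection reduction)
  apply b15Leaf_WOfRecord₁₃_liveRepin₁₃_of_massLive_of_hasResiduals Θ _ hres (P := P)
  · exact hkP
  · exact hpin P hkP
  · exact hmassLive P hkP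
  · exact hP P
  · exact h180 P hkP
  · exact h189 P hkP

end Live


section Witness
variable (lam : ResidW F N)

variable (ε₀ ε₂₉ B₃ a₀ a₁ : ℝ) in
/-- **★★★ THE SAME AT node00-def-K0a's `L`-KEYED [15]-KEYED WITNESS `θ₁₅ᶜ = theta13OfThm1C F N ε₀ ε₂₉ B₃ a₀ a₁`, ZERO K0-SIDE HYPOTHESES** — the previous theorem at
`Θ := theta13OfNumerics F N (stage12NumericsOfThm1C F.L ε₀ B₃ a₀ a₁) ε₂₉ …` (`θ₁₅ᶜ = Θ.liveRepin₁₃` by `rfl`) with `hres := hasResidualsOfRecord_theta13OfNumerics`: N12's row for every run below the torus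
at the plan's witness with the Proposition-1 display DISCHARGED at print's SU(2) box instance of (1.77) at NODE 00's solution map; displayed: pin equation, live-mass, (1.80), (1.89), and dag-n12-c's
instance data + `hreg` + letters (J1)∕(L2)∕(L3).  Count-neutral; NOT a discharge of N12.
[cite: Balaban1989LargeFieldI, (0.2)–(0.6) p.176, Prop. 1 (1.77)–(1.78) p.194, p.193, (1.80) p.195, (1.89) p.198, (1.99)–(1.102) pp.200–201; Balaban1989LargeFieldII, (1.7)–(1.9) p.358, (1.11)–(1.13) p.359; Balaban1985Variational, Thm 1 p.279 (witness letters only); Balaban1988Convergent, (2.12) p.256, (3.16) p.268, (3.22)–(3.25) pp.269–270 (bookkeeping)] -/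
theorem exists_pinLF_b15Leaf_WOfRecord₁₃_theta13OfThm1C_of_massLive_of_intrinsicLettersOfRecord
    -- N12's displays at the letters `kSel ∕ D189 ∕ D1100` of `λ`, run by run, BELOW THE TORUS
    (hpin : ∀ P : B12.RunParams, lam.kSel P < P.K → lam.D1100 P
      = rPrimeDataOfSel (reprTOfRecord₁₃ F N (theta13OfThm1C F N ε₀ ε₂₉ B₃ a₀ a₁) P (lam.kSel P))
          ((theta13OfThm1C F N ε₀ ε₂₉ B₃ a₀ a₁).ppSel P (gOfRecord₁₃ F N (theta13OfThm1C F N ε₀ ε₂₉ B₃ a₀ a₁) P) (lam.kSel P + 1))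
          (fibOfSeq F (theta13OfThm1C F N ε₀ ε₂₉ B₃ a₀ a₁).ν (theta13OfThm1C F N ε₀ ε₂₉ B₃ a₀ a₁).τ9 P (gOfRecord₁₃ F N (theta13OfThm1C F N ε₀ ε₂₉ B₃ a₀ a₁) P) (lam.kSel P + 1)))
    (hmassLive : ∀ P : B12.RunParams, lam.kSel P < P.K → ∀ s, LiveSeq F N (theta13OfThm1C F N ε₀ ε₂₉ B₃ a₀ a₁).ν (theta13OfThm1C F N ε₀ ε₂₉ B₃ a₀ a₁).τ9 P (gOfRecord₁₃ F N (theta13OfThm1C F N ε₀ ε₂₉ B₃ a₀ a₁) P) (lam.kSel P + 1)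
        (slotsTOfRecord F N (theta13OfThm1C F N ε₀ ε₂₉ B₃ a₀ a₁).ν (theta13OfThm1C F N ε₀ ε₂₉ B₃ a₀ a₁).τ9 (EOfRecord₁₃ F N (theta13OfThm1C F N ε₀ ε₂₉ B₃ a₀ a₁)) (wOfRecord₉ F N (theta13OfThm1C F N ε₀ ε₂₉ B₃ a₀ a₁).toStage9Params)
          (theta13OfThm1C F N ε₀ ε₂₉ B₃ a₀ a₁).ppSel P (gOfRecord₁₃ F N (theta13OfThm1C F N ε₀ ε₂₉ B₃ a₀ a₁) P) (lam.kSel P + 1)) s →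
      0 < ∫ V, rterm (reprTOfRecord₁₃ F N (theta13OfThm1C F N ε₀ ε₂₉ B₃ a₀ a₁) P (lam.kSel P)) s V ∂(fieldMeasure (F.P P.K) (lam.kSel P + 1) (SU N)))
    (h180 : ∀ P : B12.RunParams, lam.kSel P < P.K → ∀ U, new189 (lam.D189 P) U → ∀ i, (lam.D189 P).h ≤ i → i ≤ (lam.D189 P).k →
      ∀ q ∈ plaqsOf (dom (lam.D189 P) i),
        Ineq180 ((lam.D189 P).dev0 U q) ((lam.D189 P).ε (lam.D189 P).k) (lam.D189 P).η (lam.D189 P).B₃ (lam.D189 P).B₅ (lam.D189 P).M (lam.D189 P).δ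
          ((lam.D189 P).dist q) (lam.D189 P).O1)
    (h189 : ∀ P : B12.RunParams, lam.kSel P < P.K → Claim189 (new189 (lam.D189 P)) (chiPP (lam.D189 P)))
    -- dag-n12-c's Proposition-1 instance data ON THE RUN's LATTICE `F.P P.K`, per run `P` and instance `i : ι P` (structural ∕ constants, exactly as in its endpoint of record)
    (hd3 : ∀ P : B12.RunParams, 3 ≤ (F.P P.K).d) (h0 : ∀ P : B12.RunParams, 0 < (F.P P.K).d) (ι : B12.RunParams → Type)
    (av : ∀ (P : B12.RunParams) (j : ℕ), Averaging (F.P P.K) j SU2)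
    -- NODE 00's (2.12) solution map of record `bgOfRecord (av P) (reg P)` in a GAUGE-INVARIANT class `reg P` (dag-n12-c FILE 1∕4: the (181) letter is GONE)
    (reg : ∀ P : B12.RunParams, Set (GaugeField (F.P P.K) 0 SU2))
    (hreg : ∀ (P : B12.RunParams) (w : GaugeTransf (F.P P.K) 0 SU2) (U : GaugeField (F.P P.K) 0 SU2), U ∈ reg P → gaugeAct w U ∈ reg P) (M₁ : B12.RunParams → ℕ) (Z Λ : ∀ P : B12.RunParams, ι P → Set (Site (F.P P.K) 0))
    (k : ∀ P : B12.RunParams, ι P → ℕ) (M : ∀ P : B12.RunParams, ι P → ℝ) (hk : ∀ P i, k P i ≤ (F.P P.K).m + (F.P P.K).K)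
    (eR : ∀ P : B12.RunParams, ι P → ℝ) (heR : ∀ P i, 0 < eR P i)
    (T : ∀ (P : B12.RunParams) (i : ι P), Finset (PBond (F.P P.K) (k P i)))
    (lo hi : ∀ P : B12.RunParams, ι P → Fin (F.P P.K).d → ℤ) (n : ∀ P : B12.RunParams, ι P → ℕ) (hn : ∀ P i κ, hi P i κ ≤ lo P i κ + n P i)
    (hN : ∀ P i, n P i + 2 < (F.P P.K).sitesPerDir (k P i))
    (hbox : ∀ P i, pts (k P i) (Λ P i) = (castSite '' Set.Icc (lo P i) (hi P i) : Set (Site (F.P P.K) (k P i))))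
    (hZ : ∀ P i, (boxPlaqs (lo P i - 1) (hi P i + 1) : Set (Plaq (F.P P.K) (k P i))) ⊆ plaqsInside (pts (k P i) (Z P i)))
    (hTG0 : ∀ P i, letI : DecidableEq (PBond (F.P P.K) (k P i)) := fun a b => Classical.propDecidable (a = b);
      T P i = (box (fun κ => (hi P i κ - lo P i κ + 1).toNat) (lo P i)).image fun x =>
      (⟨castSite (x - unitVec ⟨0, h0 P⟩), ⟨0, h0 P⟩⟩ : PBond (F.P P.K) (k P i)))
    (hN5 : ∀ P i κ, ((hi P i κ - lo P i κ + 1).toNat : ℤ) + 5 < (F.P P.K).sitesPerDir (k P i))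
    (Kb : ∀ P : B12.RunParams, ι P → ℕ) (hK1 : ∀ P i, 1 ≤ Kb P i) (hKn : ∀ P i κ, (hi P i κ - lo P i κ + 1).toNat ≤ Kb P i)
    (ext : ∀ (P : B12.RunParams) (i : ι P), GaugeField (F.P P.K) (k P i) SU2 → GaugeField (F.P P.K) (k P i) SU2)
    (hext : ∀ P i Vk, ext P i Vk = extend (pts (k P i) (Λ P i)) (shellGauge Vk (lo P i) (hi P i)) Vk)
    (hlohi : ∀ P i, lo P i ≤ hi P i)
    {γ cJ bx : B12.RunParams → ℝ} (hγ : ∀ P, 0 < γ P) (hcJ : ∀ P, 0 ≤ cJ P) (hbx : ∀ P, 0 ≤ bx P)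
    (hbxM : ∀ P i, 12 * ((F.P P.K).d : ℝ) * ((n P i : ℝ) + 2) ^ 2 ≤ bx P * (M P i) ^ 2)
    {Cerr R 𝓐 : ∀ P : B12.RunParams, ι P → ℝ} (hM : ∀ P i, 1 ≤ M P i) (hR : ∀ P i, 0 < R P i) (h𝓐 : ∀ P i, 0 ≤ 𝓐 P i)
    (n' : ∀ P : B12.RunParams, ι P → ℕ) (hn' : ∀ P i, 1 ≤ n' P i)
    -- (J1) the JOINT holomorphic extension of print's function in the datum perturbation and the field
    (hGj : ∀ P i Vk, PlaqSmallOn (plaqsInside (pts (k P i) (Z P i ∩ (Λ P i)ᶜ))) (eR P i) Vk →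
      ∃ 𝒢 : VecField (F.P P.K) (k P i) (EuclideanSpace ℂ (Fin 3)) × VecField (F.P P.K) (k P i) (EuclideanSpace ℂ (Fin 3)) → ℂ,
        DifferentiableOn ℂ 𝒢 (ball 0 (R P i)) ∧
        (∀ z ∈ ball (0 : VecField (F.P P.K) (k P i) (EuclideanSpace ℂ (Fin 3)) × VecField (F.P P.K) (k P i) (EuclideanSpace ℂ (Fin 3))) (R P i), ‖𝒢 z‖ ≤ 𝓐 P i) ∧
        ∀ p B' : VecField (F.P P.K) (k P i) E3, ‖p‖ < R P i → ‖B'‖ < R P i →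
          𝒢 (cplxVec p, cplxVec B') =
            ((fun177std (bgOfRecord (av P) (reg P)) (M₁ P) (Z P i) (k P i) (expMul su2Chart B' (ext P i (expMul su2Chart p Vk))) : ℝ) : ℂ))
    -- (L2) (1.7)–(1.9) p.358 for the Hessian of the slice function at `0`
    (hlead : ∀ P i Vk, letI : DecidableEq (PBond (F.P P.K) (k P i)) := fun a b => Classical.propDecidable (a = b);
      PlaqSmallOn (plaqsInside (pts (k P i) (Z P i ∩ (Λ P i)ᶜ))) (eR P i) Vk →
      ∀ X : GaugeSlice (pts (k P i) (Λ P i)) (T P i) E3,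
      |⟪X, (fderiv ℝ (rGrad (pts (k P i) (Λ P i)) (T P i)
              (sliceFn (pts (k P i) (Λ P i)) (T P i) (fun177std (bgOfRecord (av P) (reg P)) (M₁ P) (Z P i) (k P i)) (ext P i Vk))) 0) X⟫ -
          ∑ a : Fin 3, formDk (n' P i) (fun _ : Fin (F.P P.K).d => (F.P P.K).sitesPerDir (k P i))
            (ofRealCfg (fun _ : Fin (F.P P.K).d => (F.P P.K).sitesPerDir (k P i)) fun j =>
              ιA (pts (k P i) (Λ P i)) (T P i) X ⟨j.1, j.2⟩ a)| ≤ Cerr P i * ‖X‖ ^ 2)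
    (hsm : ∀ P i, Cerr P i ≤ (4 / Real.pi ^ 2) ^ ((F.P P.K).d + 2) / (2 * (3 * (Kb P i : ℝ) ^ 2 + 2 * (Kb P i : ℝ) ^ 4)))
    (hγle : ∀ P i, γ P / (M P i) ^ 5 ≤ (4 / Real.pi ^ 2) ^ ((F.P P.K).d + 2) / (2 * (3 * (Kb P i : ℝ) ^ 2 + 2 * (Kb P i : ℝ) ^ 4)))
    -- (L3) p.359: the gradient at `0` is small at regular data
    (hJ : ∀ P i ε Vk, letI : DecidableEq (PBond (F.P P.K) (k P i)) := fun a b => Classical.propDecidable (a = b);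
      0 < ε → ε ≤ eR P i → PlaqSmallOn (plaqsInside (pts (k P i) (Z P i ∩ (Λ P i)ᶜ))) ε Vk →
      ‖rGrad (pts (k P i) (Λ P i)) (T P i) (sliceFn (pts (k P i) (Λ P i)) (T P i) (fun177std (bgOfRecord (av P) (reg P)) (M₁ P) (Z P i) (k P i)) (ext P i Vk)) 0‖ ≤ cJ P * ε) :
    ∃ areg : ∀ P : B12.RunParams, ι P → ℝ, (∀ P i, 0 < areg P i) ∧
      ∀ P : B12.RunParams, lam.kSel P < P.K →
        B15Leaf (WOfRecord₁₃ F N (theta13OfThm1C F N ε₀ ε₂₉ B₃ a₀ a₁)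
          { lam with LF := fun P => lfVarOn su2Chart fun i => letI : DecidableEq (PBond (F.P P.K) (k P i)) := fun a b => Classical.propDecidable (a = b);
                          InstOn.std (bgOfRecord (av P) (reg P)) (M₁ P) (Z P i) (Λ P i) (k P i) (M P i) (areg P i)
                            (anExt (pts (k P i) (Λ P i)) (T P i) (fun177std (bgOfRecord (av P) (reg P)) (M₁ P) (Z P i) (k P i)) (ext P i)
                              (min (1 / 2) (min (R P i / 8) (γ P / (M P i) ^ 5 * (R P i / 2) ^ 2 / (48 * (4 * 𝓐 P i / R P i + 1)))))) } P) :=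
  exists_pinLF_b15Leaf_WOfRecord₁₃_liveRepin₁₃_of_massLive_of_hasResiduals_of_intrinsicLettersOfRecord
    (theta13OfNumerics F N (stage12NumericsOfThm1C F.L ε₀ B₃ a₀ a₁) ε₂₉ (zeta316OfRecord F N (stage12NumericsOfThm1C F.L ε₀ B₃ a₀ a₁).ν (stage12NumericsOfThm1C F.L ε₀ B₃ a₀ a₁).τ9.M (stage12NumericsOfThm1C F.L ε₀ B₃ a₀ a₁).A₁) (RzOfRecord F N) (ZtOfRecord F N)) lam
    (hasResidualsOfRecord_theta13OfNumerics F N (stage12NumericsOfThm1C F.L ε₀ B₃ a₀ a₁) ε₂₉) hpin hmassLive h180 h189 hd3 h0 ι av reg hreg M₁ Z Λ k M hk eR heR T lo hi n hn hN hbox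
    hZ hTG0 hN5 Kb hK1 hKn ext hext hlohi hγ hcJ hbx hbxM hM hR h𝓐 n' hn' hGj hlead hsm hγle hJ

end Witness

/-! ## §2. `N = 2`: the background pinned to the v1.5 `CoP` background constructor of record `bgMSCoPOfRecord` (`M₁ := Θ.ν.M₁`) -/

section RecordBackground
variable (Θ : Stage13Params F 2) (lam : ResidW F 2)

/-- **★★★ AT `N = 2`, THE BACKGROUND := THE v1.5 `CoP` BACKGROUND CONSTRUCTOR OF RECORD** — §1's first theorem with `av := avOfRecord F 2 P.K`,
`reg := regMSCoPOfRecordAt F 2 Θ.ν P.K (kb P) (suppDomOfRecord F Θ.ν P.K (Ω P)) (Ω P)` (so the background IS `bgMSCoPOfRecord F 2 Θ.ν P.K (kb P) (Ω P)`, node00-def-R FILE 22′, by `rfl`), `M₁ := Θ.ν.M₁`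
(the (2.13) layer width of record) and the class gauge-invariance letter DISCHARGED by dag-n12-c's `B15Eq177ValueInvarianceCoDiv.gaugeAct_mem_regMSCoPOfRecordAt` ([15] p. 278 *«The space
𝔘_k({Ω_j}, ε₀) is gauge invariant»*, both the (1.7) and the (1.9) halves).  Letters: ONE class per run (`kb P`, `Ω P`) — print's term-by-term backgrounds (one per large-field history `s`) are NODE 00's
LF pin; regions, levels, `M`, box data; the three letters (J1)∕(L2)∕(L3) and `hk`.  Count-neutral; NOT a discharge of N12.
[cite: Balaban1989LargeFieldI, (0.2)–(0.6) p.176, Prop. 1 (1.77)–(1.78) p.194, p.193, (1.80) p.195, (1.89) p.198, (1.99)–(1.102) pp.200–201; Balaban1989LargeFieldII, (1.7)–(1.9) p.358, (1.11)–(1.13) p.359; Balaban1988Convergent, (2.12)–(2.13) pp.256–257, (3.16) p.268; Balaban1985Variational, p.278, (6) p.278 (bookkeeping)] -/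
theorem exists_pinLF_b15Leaf_WOfRecord₁₃_liveRepin₁₃_of_massLive_of_hasResiduals_of_intrinsicLetters_bgMSCoPOfRecord (hres : Θ.HasResidualsOfRecord F 2)
    -- N12's displays at the letters `kSel ∕ D189 ∕ D1100` of `λ`, run by run, BELOW THE TORUS
    (hpin : ∀ P : B12.RunParams, lam.kSel P < P.K → lam.D1100 P
      = rPrimeDataOfSel (reprTOfRecord₁₃ F 2 (Θ.liveRepin₁₃ F 2) P (lam.kSel P))
          ((Θ.liveRepin₁₃ F 2).ppSel P (gOfRecord₁₃ F 2 (Θ.liveRepin₁₃ F 2) P) (lam.kSel P + 1))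
          (fibOfSeq F (Θ.liveRepin₁₃ F 2).ν (Θ.liveRepin₁₃ F 2).τ9 P (gOfRecord₁₃ F 2 (Θ.liveRepin₁₃ F 2) P) (lam.kSel P + 1)))
    (hmassLive : ∀ P : B12.RunParams, lam.kSel P < P.K → ∀ s, LiveSeq F 2 Θ.ν Θ.τ9 P (gOfRecord₁₃ F 2 (Θ.liveRepin₁₃ F 2) P) (lam.kSel P + 1)
        (slotsTOfRecord F 2 Θ.ν Θ.τ9 (EOfRecord₁₃ F 2 (Θ.liveRepin₁₃ F 2)) (wOfRecord₉ F 2 (Θ.liveRepin₁₃ F 2).toStage9Params)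
          (Θ.liveRepin₁₃ F 2).ppSel P (gOfRecord₁₃ F 2 (Θ.liveRepin₁₃ F 2) P) (lam.kSel P + 1)) s →
      0 < ∫ V, rterm (reprTOfRecord₁₃ F 2 (Θ.liveRepin₁₃ F 2) P (lam.kSel P)) s V ∂(fieldMeasure (F.P P.K) (lam.kSel P + 1) (SU 2)))
    (h180 : ∀ P : B12.RunParams, lam.kSel P < P.K → ∀ U, new189 (lam.D189 P) U → ∀ i, (lam.D189 P).h ≤ i → i ≤ (lam.D189 P).k →
      ∀ q ∈ plaqsOf (dom (lam.D189 P) i),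
        Ineq180 ((lam.D189 P).dev0 U q) ((lam.D189 P).ε (lam.D189 P).k) (lam.D189 P).η (lam.D189 P).B₃ (lam.D189 P).B₅ (lam.D189 P).M (lam.D189 P).δ
          ((lam.D189 P).dist q) (lam.D189 P).O1)
    (h189 : ∀ P : B12.RunParams, lam.kSel P < P.K → Claim189 (new189 (lam.D189 P)) (chiPP (lam.D189 P)))
    -- dag-n12-c's Proposition-1 instance data ON THE RUN's LATTICE `F.P P.K`, per run `P` and instance `i : ι P` (structural ∕ constants, exactly as in its endpoint of record)
    (hd3 : ∀ P : B12.RunParams, 3 ≤ (F.P P.K).d) (h0 : ∀ P : B12.RunParams, 0 < (F.P P.K).d) (ι : B12.RunParams → Type)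
    -- THE v1.5 BACKGROUND CONSTRUCTOR OF RECORD (node00-def-R FILE 22′): ONE (1.7)∧(1.9)-class per run — its step count `kb P` and region history `Ω P` are letters
    (kb : B12.RunParams → ℕ) (Ω : ∀ P : B12.RunParams, ℕ → Set (Site (F.P P.K) 0)) (Z Λ : ∀ P : B12.RunParams, ι P → Set (Site (F.P P.K) 0))
    (k : ∀ P : B12.RunParams, ι P → ℕ) (M : ∀ P : B12.RunParams, ι P → ℝ) (hk : ∀ P i, k P i ≤ (F.P P.K).m + (F.P P.K).K)
    (eR : ∀ P : B12.RunParams, ι P → ℝ) (heR : ∀ P i, 0 < eR P i)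
    (T : ∀ (P : B12.RunParams) (i : ι P), Finset (PBond (F.P P.K) (k P i)))
    (lo hi : ∀ P : B12.RunParams, ι P → Fin (F.P P.K).d → ℤ) (n : ∀ P : B12.RunParams, ι P → ℕ) (hn : ∀ P i κ, hi P i κ ≤ lo P i κ + n P i)
    (hN : ∀ P i, n P i + 2 < (F.P P.K).sitesPerDir (k P i))
    (hbox : ∀ P i, pts (k P i) (Λ P i) = (castSite '' Set.Icc (lo P i) (hi P i) : Set (Site (F.P P.K) (k P i))))
    (hZ : ∀ P i, (boxPlaqs (lo P i - 1) (hi P i + 1) : Set (Plaq (F.P P.K) (k P i))) ⊆ plaqsInside (pts (k P i) (Z P i)))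
    (hTG0 : ∀ P i, letI : DecidableEq (PBond (F.P P.K) (k P i)) := fun a b => Classical.propDecidable (a = b);
      T P i = (box (fun κ => (hi P i κ - lo P i κ + 1).toNat) (lo P i)).image fun x =>
      (⟨castSite (x - unitVec ⟨0, h0 P⟩), ⟨0, h0 P⟩⟩ : PBond (F.P P.K) (k P i)))
    (hN5 : ∀ P i κ, ((hi P i κ - lo P i κ + 1).toNat : ℤ) + 5 < (F.P P.K).sitesPerDir (k P i))
    (Kb : ∀ P : B12.RunParams, ι P → ℕ) (hK1 : ∀ P i, 1 ≤ Kb P i) (hKn : ∀ P i κ, (hi P i κ - lo P i κ + 1).toNat ≤ Kb P i)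
    (ext : ∀ (P : B12.RunParams) (i : ι P), GaugeField (F.P P.K) (k P i) SU2 → GaugeField (F.P P.K) (k P i) SU2)
    (hext : ∀ P i Vk, ext P i Vk = extend (pts (k P i) (Λ P i)) (shellGauge Vk (lo P i) (hi P i)) Vk)
    (hlohi : ∀ P i, lo P i ≤ hi P i)
    {γ cJ bx : B12.RunParams → ℝ} (hγ : ∀ P, 0 < γ P) (hcJ : ∀ P, 0 ≤ cJ P) (hbx : ∀ P, 0 ≤ bx P)
    (hbxM : ∀ P i, 12 * ((F.P P.K).d : ℝ) * ((n P i : ℝ) + 2) ^ 2 ≤ bx P * (M P i) ^ 2)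
    {Cerr R 𝓐 : ∀ P : B12.RunParams, ι P → ℝ} (hM : ∀ P i, 1 ≤ M P i) (hR : ∀ P i, 0 < R P i) (h𝓐 : ∀ P i, 0 ≤ 𝓐 P i)
    (n' : ∀ P : B12.RunParams, ι P → ℕ) (hn' : ∀ P i, 1 ≤ n' P i)
    -- (J1) the JOINT holomorphic extension of print's function in the datum perturbation and the field
    (hGj : ∀ P i Vk, PlaqSmallOn (plaqsInside (pts (k P i) (Z P i ∩ (Λ P i)ᶜ))) (eR P i) Vk →
      ∃ 𝒢 : VecField (F.P P.K) (k P i) (EuclideanSpace ℂ (Fin 3)) × VecField (F.P P.K) (k P i) (EuclideanSpace ℂ (Fin 3)) → ℂ,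
        DifferentiableOn ℂ 𝒢 (ball 0 (R P i)) ∧
        (∀ z ∈ ball (0 : VecField (F.P P.K) (k P i) (EuclideanSpace ℂ (Fin 3)) × VecField (F.P P.K) (k P i) (EuclideanSpace ℂ (Fin 3))) (R P i), ‖𝒢 z‖ ≤ 𝓐 P i) ∧
        ∀ p B' : VecField (F.P P.K) (k P i) E3, ‖p‖ < R P i → ‖B'‖ < R P i →
          𝒢 (cplxVec p, cplxVec B') =
            ((fun177std (bgMSCoPOfRecord F 2 Θ.ν P.K (kb P) (Ω P)) Θ.ν.M₁ (Z P i) (k P i) (expMul su2Chart B' (ext P i (expMul su2Chart p Vk))) : ℝ) : ℂ))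
    -- (L2) (1.7)–(1.9) p.358 for the Hessian of the slice function at `0`
    (hlead : ∀ P i Vk, letI : DecidableEq (PBond (F.P P.K) (k P i)) := fun a b => Classical.propDecidable (a = b);
      PlaqSmallOn (plaqsInside (pts (k P i) (Z P i ∩ (Λ P i)ᶜ))) (eR P i) Vk →
      ∀ X : GaugeSlice (pts (k P i) (Λ P i)) (T P i) E3,
      |⟪X, (fderiv ℝ (rGrad (pts (k P i) (Λ P i)) (T P i)
              (sliceFn (pts (k P i) (Λ P i)) (T P i) (fun177std (bgMSCoPOfRecord F 2 Θ.ν P.K (kb P) (Ω P)) Θ.ν.M₁ (Z P i) (k P i)) (ext P i Vk))) 0) X⟫ -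
          ∑ a : Fin 3, formDk (n' P i) (fun _ : Fin (F.P P.K).d => (F.P P.K).sitesPerDir (k P i))
            (ofRealCfg (fun _ : Fin (F.P P.K).d => (F.P P.K).sitesPerDir (k P i)) fun j =>
              ιA (pts (k P i) (Λ P i)) (T P i) X ⟨j.1, j.2⟩ a)| ≤ Cerr P i * ‖X‖ ^ 2)
    (hsm : ∀ P i, Cerr P i ≤ (4 / Real.pi ^ 2) ^ ((F.P P.K).d + 2) / (2 * (3 * (Kb P i : ℝ) ^ 2 + 2 * (Kb P i : ℝ) ^ 4)))
    (hγle : ∀ P i, γ P / (M P i) ^ 5 ≤ (4 / Real.pi ^ 2) ^ ((F.P P.K).d + 2) / (2 * (3 * (Kb P i : ℝ) ^ 2 + 2 * (Kb P i : ℝ) ^ 4)))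
    -- (L3) p.359: the gradient at `0` is small at regular data
    (hJ : ∀ P i ε Vk, letI : DecidableEq (PBond (F.P P.K) (k P i)) := fun a b => Classical.propDecidable (a = b);
      0 < ε → ε ≤ eR P i → PlaqSmallOn (plaqsInside (pts (k P i) (Z P i ∩ (Λ P i)ᶜ))) ε Vk →
      ‖rGrad (pts (k P i) (Λ P i)) (T P i) (sliceFn (pts (k P i) (Λ P i)) (T P i) (fun177std (bgMSCoPOfRecord F 2 Θ.ν P.K (kb P) (Ω P)) Θ.ν.M₁ (Z P i) (k P i)) (ext P i Vk)) 0‖ ≤ cJ P * ε) :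
    ∃ areg : ∀ P : B12.RunParams, ι P → ℝ, (∀ P i, 0 < areg P i) ∧
      ∀ P : B12.RunParams, lam.kSel P < P.K →
        B15Leaf (WOfRecord₁₃ F 2 (Θ.liveRepin₁₃ F 2)
          { lam with LF := fun P => lfVarOn su2Chart fun i => letI : DecidableEq (PBond (F.P P.K) (k P i)) := fun a b => Classical.propDecidable (a = b);
                          InstOn.std (bgMSCoPOfRecord F 2 Θ.ν P.K (kb P) (Ω P)) Θ.ν.M₁ (Z P i) (Λ P i) (k P i) (M P i) (areg P i)
                            (anExt (pts (k P i) (Λ P i)) (T P i) (fun177std (bgMSCoPOfRecord F 2 Θ.ν P.K (kb P) (Ω P)) Θ.ν.M₁ (Z P i) (k P i)) (ext P i)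
                              (min (1 / 2) (min (R P i / 8) (γ P / (M P i) ^ 5 * (R P i / 2) ^ 2 / (48 * (4 * 𝓐 P i / R P i + 1)))))) } P) := by
  -- the v1.5 background constructor of record IS `bgOfRecord (avOfRecord F 2 P.K) (regMSCoPOfRecordAt …)` (node00-def-R FILE 22′, by delta): expand it by name, then §1 applies verbatim
  delta bgMSCoPOfRecord bgMSCoPOfRecordAt at hGj hlead hJ ⊢
  exact exists_pinLF_b15Leaf_WOfRecord₁₃_liveRepin₁₃_of_massLive_of_hasResiduals_of_intrinsicLettersOfRecord Θ lam hres hpin hmassLive h180 h189 hd3 h0 ι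
    (fun P => avOfRecord F 2 P.K) (fun P => regMSCoPOfRecordAt F 2 Θ.ν P.K (kb P) (suppDomOfRecord F Θ.ν P.K (Ω P)) (Ω P))
    (fun P => gaugeAct_mem_regMSCoPOfRecordAt Θ.ν P.K (kb P) (suppDomOfRecord F Θ.ν P.K (Ω P)) (Ω P)) (fun _ => Θ.ν.M₁) Z Λ k M hk eR heR T lo hi n hn hN
    hbox hZ hTG0 hN5 Kb hK1 hKn ext hext hlohi hγ hcJ hbx hbxM hM hR h𝓐 n' hn' hGj hlead hsm hγle hJ

end RecordBackground

end Summit.QuantumFields.YangMills.BalabanUVNodes.N12AtRecord13Prop1Knit
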